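import Literature.NumberTheory.EllipticCurves.PNewBranchGaloisLattice
import Literature.NumberTheory.EllipticCurves.PadicSeriesEvaluation
import HarnessLib

/-!
# Hida, Invent. Math. 85 (1986) Thm. 2.1 (2.2b)/(2.2c) read VERBATIM on the analytic chart of
# `PNewBranchAnalyticChartTwoVariableBDP`: the big Galois lattice `π : Γ_ℚ → GL₂(ℤ_p⟦X⟧)` of the ordinary branch through a
# `p`-NEW weight-2 newform `f_E`, UNTWISTED, its reductions at the points `X = 0` and `X = x_t` «equivalent as Galois
# representations into `GL₂(Ω)`», `Ω = ℂ_p`, to `V_pE` and to Deligne's representations of the members — packaged with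
# Castella's two-variable BDP function on the SAME chart (the print-verbatim sibling «T-An-2ᴴ» of T-An-2ᵍ)

Trunk `Literature/NumberTheory/EllipticCurves`. Cell `bsd-eis` (HOME `run/shared/lean/pub/bsd-eis/`), ideator seat
`bsd-idea-12` g42 (re-issued g43 after review of p772614: sources for `p = 3`, locators), for crux 4 `BSDpOnCellC`
(stmt-BirchSwinnertonDyer-19034), line «telescope». The skeleton of record v17
(LEAD cruxlead-19034 g5, sha256 0a0d0fdb…, four stubs) carries the assembled fact T-An-2ᵍ
`hida1986_castella2020_exists_galoisLattice_on_pNewBranchChart` (sibling module `PNewBranchGaloisLattice`) BY NAME as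
`stub_assembledFactsG`; its Galois clause `IsBranchGaloisLattice` states the member fibres IN THE CRITICAL TWIST,
conjugate over the SMALL fields `ℚ_p` / `K_t`, in Weierstrass-remainder form — three normalisations ((D5) descent,
(D8) twist, (D9) remainder of that module's transcription) which are print-adjacent but not print. The width seat x2-p2 g24
has since PROVED those three steps in the tree (Summits side: `…Theorems.TelescopeBranchConjDescent` p769852,
`…TelescopeBranchTwistExpSeries` p770433, `…TelescopeBranchTwistCharacter`, `…TelescopeBranchLatticeOfUntwisted`), so the
load-bearing fact can now be RE-TYPED CLOSER TO PRINT: this module states Hida's (2.2b)/(2.2c) in their own shape —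
UNTWISTED member representations (Deligne's `(D t).Δ.ρ`, not the self-dual twist), equivalence OVER `Ω = ℂ_p` (Hida's
`Ω`, «a p-adic completion of an algebraic closure of `Q_p`»), reductions as honest SPECIALISATIONS `F ↦ F(x_t)` (the
tree's `evalHom (x t)`) — and the tree recovers T-An-2ᵍ from it (a Summits theorem «T-An-2ᴴ ⊢ T-An-2ᵍ», x2-p2 g24's
`exists_isBranchGaloisLattice_of_untwisted_eval_conjOver` composed with the chart projections). ONE predicate WITH A BODY
(`IsUntwistedBranchGaloisLattice`, clauses (U-unr)/(U-fib₀)/(U-fib_t)/(U-rat)) and ONE named fact (`def … : Prop`, D-0014,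
nothing asserted, no `_holds`) `hida1986_castella2020_exists_untwistedGaloisLattice_on_pNewBranchChart` = T-An-2
(`castella2020_exists_twoVariableBDP_on_pNewBranchChart`; binders VERBATIM, conclusion VERBATIM) strengthened INSIDE THE
SAME `∃ (A, x, D)` by `∃ π, IsUntwistedBranchGaloisLattice W p x D π`; nothing else. No instance, no notation, no `sorry`;
nothing re-declared (`FramedGaloisRep`, `PowerSeries.WithPiTopology`, the tree's `WeierstrassCurve.galoisRepTate`,
`OrdinaryNewformDatum.ρ`, `GreenbergSelmer.padicCoeffField/padicCoeffIntegers`, `evalHom`, Mathlib's `ℂ_[p] = PadicComplex p`).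
HONEST FRAMING: BSD is proved for no curve by this; no Galois representation is constructed here; crux 4 is not closed by
typing; logically T-An-2ᴴ is AT LEAST AS STRONG as T-An-2ᵍ (the tree proves «⇒»): what improves is SOURCING, not strength.

## Why a SIBLING fact and why ONE ∃-package — as in the sibling module (same paragraph applies verbatim): the Galois
clauses speak of the fibres AT THE MEMBER POINTS `x_t` against the members' data `(D t).Δ`, so they live on the chart data
`(x, D)` that T-An-2 produces; «for every chart there is a lattice» would be STRONGER than print; one ∃ is what print does
(ONE branch `𝓘(𝒦)` carrying Hida's `π` and Castella's `L_p(𝐟)`).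

## Sources, verbatim (read first-hand; printed-page locators of [Hida1986] per referee bsd-eis-ref g150, REF-VERDICT-WAVE-g150
§IV.9 / n-g150-2; held text `paper:galaxy-pdf-386122223565667620`, chunk locators in parentheses)

**[Hida1986]** H. Hida, *Galois representations into `GL₂(ℤ_p⟦X⟧)` attached to ordinary cusp forms*, Invent. Math. 85
(1986) 545–613. Intro (p. 545; p0001): «Assume throughout the paper that `p ≥ 5`.» «Let `Ω` be a p-adic completion of an
algebraic closure of `Q_p`.» **Notation** (p0005): «We write `Ω` for the p-adic completion of an algebraic closure of `Q_p`
and throughout this paper, we fix an embedding: `Q̄ ↪ Ω` … Any extension of `Q_p` will be considered in `Ω`.» §2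
Terminology (p. 557; p0016): «a representation `π` of `𝔊` into `GL₂(𝒦)` is continuous if (i) `π` can be realized on a two
dimensional `𝒦`-vector space `V` with a `𝓘(𝒦)`-lattice `L` … stable under `𝔊`, (ii) `π : 𝔊 → Aut_{𝓘(𝒦)}(L)` is
continuous … the topology of the projective limit `lim Aut(L/𝔪ʲL)`»; «For each prime divisor `P` of `𝓘(𝒦)`, …
`L_P = L ⊗ 𝓘(𝒦)_P` is free of rank 2 over `𝓘(𝒦)_P` … The reduction `π mod P` is defined to be the semi-simplification
… If `π mod P` is simple, then `π mod P` coincides with the combination of `π` and the reduction map.» (p. 557; p0016–p0017)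
«`π(f)`» is the representation into `GL₂(Ω)` «associated with the primitive form corresponding to `f`» with «(2.1a)
unramified outside `Np`; (2.1b) `det(1 − π(σ_l)X) = 1 − a(l, f)X + ψ(l)l^{k−1}X²`» (Hida's `N` = the TAME level).
**Thm. 2.1** (p. 557; p0017): «Let `𝒦` be a primitive local ring of `𝒽(N; K)`. Then there exists a continuous representation
of `𝔊` into `GL₂(𝒦)` characterized by the following properties: (2.2a) `π` is simple; (2.2b) `π` is unramified outside
`Np`; (2.2c) For each ordinary form `f` of weight `k ≥ 2` belonging to `𝒦`, the reduction `π mod P_f` is equivalent to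
`π(f)` as a Galois representation into `GL₂(Ω)`.» NO hypothesis on the residual representation. **§8** (pp. 594–599;
p0057–p0062): construction from `𝒯⁰_∞ ⊗ Λ_K`; (p. 597) «Thus `π mod P_f` is isomorphic to `π(f)`. Since `π(f)` is
simple, `π` is also simple.» **Cor. 1.3** (p. 554; p0013), **Cor. 1.4** (p. 555; p0013): quoted in
`PNewBranchAnalyticChartTwoVariableBDP` (uniqueness/primitivity of the component through a form of conductor divisible by
`N`; étaleness of `Λ_K → 𝓘(𝒦)` at `P_{k,ε}`). The classical inputs named below ([Ribet1977] irreducibility of `π(f)`,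
Eichler–Shimura/[Carayol1986] for `π(f_E) ≅ V_pE ⊗ Ω`, [Serre1968] for `V_pE` when `E` has a multiplicative prime,
[BrunsHerzog1998] 1.3.3/1.4.1/1.4.19/2.2.7 for the hull) are cited by key exactly as in the sibling module, whose
Sources section (with [Howard2007BigHeegner], [Delbourgo2008]) applies; [Howard2007BigHeegner] Def. 2.1.3 (the critical
twist) is NOT used by THIS statement — the twist is now a tree theorem.

## Transcription (print → the four clauses; what is VERBATIM and what is a rider)

SETTING as in the sibling module: `W/ℚ` globally minimal, conductor `N`, newform `f = f_E`; `p` odd, `p ∥ N` (so `f` is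
`p`-new and ordinary, `a_p = ±1`, tame level `M = N/p`); `𝒦` THE primitive component of tame level `M` through `f`
([Hida1986] Cor. 1.3), `𝓘 = 𝓘(𝒦)`; `R := ℤ_p⟦X⟧`. (D1) [Thm. 2.1 + p. 557] Hida's `𝔊`-stable `𝓘`-lattice `L ⊂ 𝒦²` with
(2.2b), (2.2c) — PRINT. (D2) the chart `𝕄̃ : 𝓘 → R` of T-An-1 (sibling fact `IsPNewBranchAnalyticChart`; member points
`𝔮_t = (X − x_t)`, `P_t = 𝕄̃⁻¹(𝔮_t)`, `𝕄̃⁻¹((X)) = P_{f_E}`) — its own named fact. (D3) base change + reflexive hull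
`T := ((L ⊗_𝓘 R)/torsion)^{**}`, FREE of rank 2 over the regular two-dimensional local ring `R` ([BrunsHerzog1998]
1.4.19/1.4.1, 2.2.7, 1.3.3), `𝔊` acting continuously for the `(p, X)`-adic = product topology; a basis gives the frame
`π : Γ_ℚ →ₜ* GL₂(ℤ_p⟦X⟧)` — RIDER `TU-hull` (classical commutative algebra ABOUT Hida's lattice; nothing over `𝓘` is
claimed). (D4) (U-unr) = (2.2b) VERBATIM («outside `Np`» = outside the primes of `N_E = Mp`). (D5♭) FIBRES = REDUCTIONS:
`R/𝔮_t = ℤ_p` by `F ↦ F(x_t)` (the tree's `evalHom (x t)`), `T_{𝔮_t} = L_{P_t} ⊗_{𝓘_{P_t}} R_{𝔮_t}` (`L_{P_t}` free of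
rank 2 over the DVR `𝓘_{P_t}`, p. 557), so the specialisation `σ ↦ (π σ)(x_t)` IS `(π mod P_t) ⊗_{κ(P_t)} ℚ_p`, a genuine
reduction (not only a semisimplification) because `π(f_{P_t})` is simple ([Ribet1977]; Hida p. 557 «coincides»); (2.2c)
then says VERBATIM: it is «equivalent to `π(f_{P_t})` as a Galois representation into `GL₂(Ω)`», `Ω = ℂ_p` — this is
(U-fib_t), with NO descent to a smaller field and NO twist. (D6) (U-rat) = the sibling's (G-rat): `κ(P_t) ↪ R/𝔮_t ⊗ ℚ =
ℚ_p`, so the member `g_t` is `ℚ_p`-rational under `ι_t`, i.e. `ℤ_p → padicCoeffIntegers (D t).ι` is onto — RIDER `TU-rat`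
(a consequence of the INTEGRAL chart, [Hida1986] Cor. 1.4 at the étale point; not a clause of Thm. 2.1). (D7) `π(f_{P_t})`
VERSUS THE TREE'S MEMBER DATUM: `f_{P_t}` is the ordinary `p`-stabilisation of the member newform `g_t` ((memb) of the
chart) and `π(f_{P_t})` := the representation of the primitive form `g_t` (p. 557), of Frobenius polynomials (2.1b)
`1 − a(l, g_t)X + l^{k_t−1}X²` (trivial character: level `Γ₀`); the tree's `(D t).Δ.ρ` (`OrdinaryNewformDatum.ρ`, over
`𝒪_t = padicCoeffIntegers (D t).ι`) has the same characteristic polynomials (`OrdinaryNewformDatum.charpoly`), so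
`π(f_{P_t}) ≅ (D t).Δ.ρ ⊗ Ω` by Chebotarev density + Brauer–Nesbitt + irreducibility — RIDER `TU-ident` (classical; if a
reader takes Hida's `σ_l` to be the geometric Frobenius where the tree's is arithmetic, replace Hida's `π` by its
contragredient lattice `σ ↦ ᵗπ(σ)⁻¹`, again continuous, free, unramified outside `Np`, with contragredient reductions:
the ∃-statement below is insensitive to the convention, flag `TU-conv`). (D7₀) AT `X = 0` (`P_{f_E}`, weight 2, where no
twist arises): `π mod P_{f_E} ≅ π(f_E)` (2.2c) and `π(f_E) ≅ V_pE ⊗ Ω = (W.galoisRepTate p) ⊗ Ω` (Eichler–Shimura +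
Faltings/[Carayol1986]: `IsNewformOf W f` gives `a_ℓ(E) = a_ℓ(f)`; `V_pE` is irreducible by [Serre1968] since `E`,
multiplicative at `p`, has no CM) — this is (U-fib₀), the reduction mod `(X)` being `F ↦ F(0) = constantCoeff F`.
NOT in this statement (moved to TREE THEOREMS, x2-p2 g24): descent of the equivalences from `Ω` to `ℚ_p` / `K_t`
(`TelescopeBranchConjDescent.exists_conj_descent(_GL)`: conjugacy over an overfield of matrix families with entries in an
INFINITE field `F` descends to `F`; no irreducibility needed); the critical twist `Θ(σ) = exp(−c_σX)`, `Θ ≡ 1 (X)`,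
`Θ(x_t) = ε(σ)^{1−k_t/2}` from (wt) `p^M x_t = k_t − 2` and (memb) `2(p−1) ∣ k_t − 2` (`TelescopeBranchTwistExpSeries`,
`TelescopeBranchTwistCharacter`); the Weierstrass remainder `F = C(F(x_t)) + (X − C x_t)·U` (`exists_eq_C_evalHom_add_X_sub_C_mul`).

## Flags (riders for the referee; nothing hidden)

* `TU-chain`: a CONJUNCTION of published results — T-An-2's chain (flags `T2-*`, `T1-*` of the sibling modules) +
  [Hida1986] Thm. 2.1 (2.2b)/(2.2c), Cor. 1.3/1.4, §8 + the classical riders `TU-hull` (D3), `TU-ident` (D7), (D7₀), with NO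
  use of the residual image (crux 4: `E[p]` reducible; Hida needs none).
* `TU-hull`: the framed module is `((L ⊗_𝓘 ℤ_p⟦X⟧)/torsion)^{**}`, not Hida's `L(𝒦)`; no freeness over `𝓘`, no integral
  fibre isomorphism, no pairing, no ordinary filtration is claimed.
* `TU-rat`: (U-rat) is (D6), a consequence of the integral chart (sibling flag `T1-R0`/`TG-rat`), kept as a clause because
  the consuming glue reads `K_t = ℚ_p` off it.
* `TU-conv`: see (D7); `TU-unr`: (U-unr) says nothing at `p` (`p ∣ N`).
* `TU-p3`: binder `2 < p` INHERITED from T-An-1/T-An-2 (flag `T1-p3`). SOURCES BY RANGE for the Galois conjunct: [Hida1986]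
  prints `p ≥ 5` (p. 545) and is the verbatim source of (2.2b)/(2.2c) there; AT `p = 3` the continuous Galois representation
  into `GL₂(𝒦)` of an ordinary component of ANY residual type, unramified outside `Np` with the Frobenius traces/determinants
  of the members, is [Wiles1988] §2.2 (pseudo-representations, any ODD prime `p`; the construction needs only `2 ∈ A^×`)
  and its main theorem on ordinary `Λ`-adic representations, Thm. 2.2.1. PROVENANCE: [Wiles1988] itself is NOT a held text
  (acq-06039; a referee page-check of ITS OWN wording is owed when it arrives) — but the theorem NUMBER, its CONTENT and its
  ODD-`p` SCOPE are confirmed FIRST-HAND in two HELD texts: (α) [SkinnerWiles1999] §3.3 (printed pp. 38–40; held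
  `paper:doi-10-1007-bf02698855`, p0035–p0037): (3.4) «Suppose that `𝔔` is a prime of `T_∞(U, 𝒪)`. Let `R = T_∞(U, 𝒪)/𝔔`
  and let `L` be the field of fractions of `R`. Note that `R` is a complete local domain. Hida has shown that there is a
  continuous, semi-simple representation `ρ_𝔔 : Gal(F̄/F) → GL₂(L)` such that (i) [odd] (ii) `ρ_𝔔` is unramified at all
  primes `ℓ ∤ np` (iii) `trace ρ_𝔔(Frob_ℓ) = T(ℓ) mod 𝔔` for all `ℓ ∤ np` (iv) `det ρ_𝔔(Frob_ℓ) = S(ℓ)Nm(ℓ) mod 𝔔` …»,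
  «By `ρ_𝔔` being continuous we mean that there is a finitely generated `Gal(F̄/F)`-stable `R`-module `ℒ` in the underlying
  representation space of `ρ_𝔔` such that `Gal(F̄/F)` acts continuously on `ℒ`», and (p. 39) «Suppose now that `𝔔` is a
  minimal prime. Using Lemma 3.8 one then deduces the existence of `ρ_𝔔` as in the proof of [W2, Theorem 2.2.1]», with
  [W2] = «A. WILES, On ordinary λ-adic representations associated to modular forms, Invent. Math. 94 (1988), 529–573»
  (p. 126; p0123) and the standing hypothesis «Throughout this paper `p` will denote an odd prime» (p. 6; p0003) — stated
  there for `F` totally real of EVEN degree and the Hecke algebras `T_∞(U, 𝒪)` of their §3 (the case `F = ℚ` is [W2]'s own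
  setting); (β) [GhateVatsal2004] (`Λ = ℤ_p⟦X⟧`, forms over `ℚ`; held `paper:doi-10-5802-aif-2077`, p0006, p0008–p0009):
  §2 (p. 2147) «References for this material are the papers [Hid86a], [Hid86b] …, and [Wil88] and Chapter 7 of [Hid93]
  (for general `p`)», (p. 2149) «Hida states his theorems in [Hid86a], [Hid86b] for `p ≥ 5`; the extension to `p = 3` is
  sketched in [Hid93], via the method of [Wil88]», §3 (pp. 2149–2150) «Let `F` be a primitive `Λ`-adic form of level `N₀`
  … Then Hida attaches a Galois representation `ρ_F : G_ℚ → GL₂(K_F)` to `F` such that for each arithmetic point `P` of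
  `L`, `P(ρ_F)`, the specialization of `ρ_F` at `P`, is isomorphic to the representation `ρ_f` attached to `f = P(F)` by
  Deligne» ([Wil88] = Invent. Math. 94 (1988), p0021). At `p = 3` the member-fibre clause (2.2c) is therefore obtained as
  «Frobenius traces/determinants of `π mod P_t` = those of `g_t`» (Wiles) + rider `TU-ident` (Chebotarev, Brauer–Nesbitt,
  [Ribet1977]) — the same rider already declared for (D7). [Delbourgo2008] p0130 records the `p = 3` caveat for ITS Thm. 4.3
  only. So the conjunct is SOURCED on the whole binder range `2 < p`: Hida for `p ≥ 5`, Wiles for `p = 3` (and all odd `p`).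
  The consuming crux (crux 4, Cell C: `p ≠ 2 ∧ E[p] reducible ∧ p ∥ N`) DOES meet `p = 3`. (Locators of [Ribet1977] Thm. 2.3,
  [Carayol1986] Thm. (A), [Serre1968] IV §2.2: cited from references.bib + reviewer s14759002 of p772614; not read first-hand
  — those three texts are not held.)
* `TU-Ω`: `Ω` is Mathlib's `ℂ_[p] = PadicComplex p` (the completion of `PadicAlgCl p`), Hida's `Ω` verbatim; the member
  coefficients enter through the tree's tower `padicCoeffField (D t).ι ⊆ PadicAlgCl p → ℂ_[p]` (instances of Mathlib's
  `IntermediateField`/`PadicComplex`; none declared here).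
* RELATION TO T-An-2ᵍ: every clause of `IsBranchGaloisLattice` follows from the clauses here by the tree theorems listed
  under «NOT in this statement» (Summits side; the bridge `T-An-2ᴴ → T-An-2ᵍ` is a provers' file, not this module's).

## References
[Hida1986] pp. 545, 554–557, 594–599 (chunks p0001, p0005, p0013, p0015–p0017, p0057–p0062); [Hida1986ENS]; [Wiles1988] §2.2,
Thm. 2.2.1 (odd `p`; not held, acq-06039); [SkinnerWiles1999] §3.3 (3.4), pp. 38–40, and p. 6, p. 126 (held
`paper:doi-10-1007-bf02698855`, p0003, p0035–p0037, p0123); [GhateVatsal2004] §2 pp. 2147, 2149, §3 pp. 2149–2150 (held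
`paper:doi-10-5802-aif-2077`, p0006, p0008–p0009); [Ribet1977] Thm. 2.3; [Serre1968] IV §2.2; [Carayol1986] Thm. (A)
(these three: locators per reviewer s14759002, texts not held); [BrunsHerzog1998] 1.3.3, 1.4.1, 1.4.19, 2.2.7;
[Delbourgo2008] Thm. 4.3, Cor. 7.3 (shape for a
multiplicative `p`; the `p = 3` caveat p0130); and the sibling modules' references for the analytic part
([Castella2020JIMJ], [Castella2018], [Castella2018Exceptional], [CastellaHsieh2018], [Venerucci2016], [GreenbergStevens1993],
[Skinner2016PacificMC]). Tree: `PNewBranchGaloisLattice.lean` (T-An-2ᵍ, `IsBranchGaloisLattice`),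
`PNewBranchAnalyticChartTwoVariableBDP.lean` (T-An-1/T-An-2, `IsPNewBranchAnalyticChart`, `norm_lt_one`),
`PadicSeriesEvaluation.lean` (`evalHom`), `TateModule.lean` (`galoisRepTate`), `GreenbergSelmerNewformDatum.lean`
(`OrdinaryNewformDatum.ρ`, `OrdinaryNewformDatum.charpoly`, `padicCoeffField`, `padicCoeffIntegers`),
`GaloisRepresentations/GaloisRep.lean` (`FramedGaloisRep`, `IsUnramifiedAt`).
-/

noncomputable section

open scoped MatrixGroups ModularForm Topology PowerSeries.WithPiTopology

open CongruenceSubgroup NumberField IsDedekindDomain Field Filter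
  Literature.NumberTheory.GaloisRepresentations
  Literature.NumberTheory.EllipticCurves.ModularForms
  Literature.NumberTheory.EllipticCurves.GreenbergSelmer

namespace Literature.NumberTheory.EllipticCurves

/-! ### §1. Hida's (2.2b)/(2.2c) on chart data, untwisted, over `Ω = ℂ_p` (a definition with a body) -/

/-- **A framed continuous rank-2 Galois lattice over `ℤ_p⟦X⟧` on the chart data `(x, D)` whose reductions at `X = 0` and
at the member points `X = x_t` are «equivalent as Galois representations into `GL₂(Ω)`», `Ω = ℂ_p`, to `V_pE` and to
Deligne's representations of the members** — Hida 1986 Thm. 2.1 (2.2b)/(2.2c) in print shape; the Galois clause of the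
named fact below. For `W/ℚ` (conductor `N`), a prime `p`, member points `x : ℕ → ℤ_p` and members
`D : ℕ → Skinner2016.HidaCongruentForm W p 1` (as in `IsPNewBranchAnalyticChart`), it says of a framed continuous
`π : Γ_ℚ →ₜ* GL₂(ℤ_p⟦X⟧)` (`FramedGaloisRep`; product = `(p, X)`-adic topology `PowerSeries.WithPiTopology`):
(U-unr) `π` is unramified at every finite place `v` of `ℚ` with `ℓ_v ∤ N` ((2.2b) «unramified outside `Np`»; here `p ∣ N`);
(U-fib₀) the reduction mod `(X)`, `σ ↦ (π σ)(0)`, is conjugate OVER `Ω = ℂ_[p]` to the Tate-module representation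
`W.galoisRepTate p` in some `ℤ_p`-basis of `T_pE` ((2.2c) at `P_{f_E}` with Eichler–Shimura, (D7₀)); (U-fib_t) for every
`t` with `‖x_t‖ < 1`, the reduction mod `(X − x_t)`, `σ ↦ (π σ)(x_t)` (the tree's `evalHom (x t)`), is conjugate OVER `Ω`
to Deligne's representation `(D t).Δ.ρ` of the member ((2.2c) at `P_t` VERBATIM, (D5♭)/(D7); UNTWISTED, no descent);
(U-rat) every member is `ℚ_p`-rational under its embedding ((D6), rider `TU-rat`). A predicate on data; nothing asserted.
Flags `TU-hull`, `TU-ident`, `TU-conv`, `TU-rat`, `TU-Ω`: module docstring.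
[cite: Hida1986, Notation ("Ω … p-adic completion of an algebraic closure of Q_p"), §2 Terminology (p. 557), Thm. 2.1 (2.2b) (2.2c) (p. 557), §8 (pp. 594–599) (Invent. Math. 85)]
[cite: Wiles1988, §2.2 (pseudo-representations, odd p) and Thm. 2.2.1 (ordinary Λ-adic Galois representations) (Invent. Math. 94 (1988) 529–573) — the source at p = 3]
[cite: SkinnerWiles1999, §3.3 (3.4) and p. 39 ("the existence of ρ_𝔔 as in the proof of (W2, Theorem 2.2.1)"; p odd, p. 6; their reference W2 = Wiles 1988, p. 126) (Publ. Math. IHES 89)]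
[cite: GhateVatsal2004, §2 (p. 2147; p. 2149: "for p ≥ 5; the extension to p = 3 is sketched in (Hid93), via the method of (Wil88)") and §3 (pp. 2149–2150: ρ_F with P(ρ_F) ≅ ρ_f) (Ann. Inst. Fourier 54)]
[cite: Ribet1977, Thm. 2.3 (irreducibility of ρ_{f,λ})] [cite: Carayol1986, Thm. (A) (local–global compatibility; π(f_E) ≅ V_pE ⊗ Ω with Eichler–Shimura)] [cite: Serre1968, IV §2.2 (V_pE irreducible for non-CM E)]
[cite: Delbourgo2008, Thm. 4.3 (ii), Cor. 7.3 (ii) ("unramified outside of Np … det(1 − ρ_{∞,E}(Frob_l)X)|_{w=k} = 1 − a_l(f_k)X + …")] -/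
def IsUntwistedBranchGaloisLattice (W : WeierstrassCurve ℚ) [W.IsElliptic] [W.IsGloballyMinimal] (p : ℕ) [Fact p.Prime]
    (x : ℕ → ℤ_[p]) (D : ℕ → Skinner2016.HidaCongruentForm W p 1)
    (π : FramedGaloisRep ℚ (PowerSeries ℤ_[p]) 2) : Prop :=
  -- (U-unr) unramified at every `v ∤ N` [Hida86 Thm. 2.1 (2.2b), verbatim]
  (∀ v : HeightOneSpectrum (𝓞 ℚ),
    ¬ ((Rat.HeightOneSpectrum.primesEquiv v : Nat.Primes) : ℕ) ∣ W.conductorNorm ℤ → π.IsUnramifiedAt v) ∧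
  -- (U-fib₀) the reduction mod `(X)` is equivalent OVER `Ω = ℂ_p` to `V_pE` [Hida86 (2.2c) at `P_{f_E}`; (D7₀)]
  (∃ (b : Module.Basis (Fin 2) ℤ_[p] (W.tateModule p)) (P : GL (Fin 2) ℂ_[p]),
    ∀ σ : absoluteGaloisGroup ℚ,
      (((π σ : GL (Fin 2) (PowerSeries ℤ_[p])) : Matrix (Fin 2) (Fin 2) (PowerSeries ℤ_[p])).map
          (fun F : PowerSeries ℤ_[p] => algebraMap ℚ_[p] ℂ_[p] ((PowerSeries.constantCoeff F : ℤ_[p]) : ℚ_[p]))) =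
        ((P : GL (Fin 2) ℂ_[p]) : Matrix (Fin 2) (Fin 2) ℂ_[p]) *
          (LinearMap.toMatrix b b (W.galoisRepTate p σ)).map (fun z : ℤ_[p] => algebraMap ℚ_[p] ℂ_[p] (z : ℚ_[p])) *
          ((P⁻¹ : GL (Fin 2) ℂ_[p]) : Matrix (Fin 2) (Fin 2) ℂ_[p])) ∧
  -- (U-fib_t) the reduction mod `(X − x_t)` = the specialisation `F ↦ F(x_t)` is equivalent OVER `Ω` to Deligne's
  --           representation of the member `g_t` [Hida86 (2.2c) at `P_t`, verbatim shape; (D5♭), (D7)]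
  (∀ (t : ℕ) (ht : ‖x t‖ < 1), ∃ P : GL (Fin 2) ℂ_[p], ∀ σ : absoluteGaloisGroup ℚ,
    ((((π σ : GL (Fin 2) (PowerSeries ℤ_[p])) : Matrix (Fin 2) (Fin 2) (PowerSeries ℤ_[p])).map (evalHom (x t) ht)).map
        (fun z : ℤ_[p] => algebraMap ℚ_[p] ℂ_[p] (z : ℚ_[p]))) =
      ((P : GL (Fin 2) ℂ_[p]) : Matrix (Fin 2) (Fin 2) ℂ_[p]) *
        ((((D t).Δ.ρ σ : GL (Fin 2) (padicCoeffIntegers (D t).ι)) :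
            Matrix (Fin 2) (Fin 2) (padicCoeffIntegers (D t).ι)).map
          (fun z : padicCoeffIntegers (D t).ι => algebraMap (padicCoeffField (D t).ι) ℂ_[p] (z : padicCoeffField (D t).ι))) *
        ((P⁻¹ : GL (Fin 2) ℂ_[p]) : Matrix (Fin 2) (Fin 2) ℂ_[p])) ∧
  -- (U-rat) the members are `ℚ_p`-rational under `ι_t`: `ℤ_p → 𝒪_t` is onto [(D6): Hida86 Cor. 1.3/1.4 at the étale point]
  (∀ t : ℕ, Function.Surjective (algebraMap ℤ_[p] (padicCoeffIntegers (D t).ι)))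

/-! ### §2. The named fact — T-An-2 with Hida's untwisted lattice on the SAME chart -/

/-- **Hida 1986 Thm. 2.1 (2.2b)/(2.2c) (with Cor. 1.3/1.4, §8) ∘ Castella 2020/2018 ∘ the chart of T-An-1 — the ordinary
branch through the `p`-NEW weight-2 newform `f_E` carries, ON ONE AND THE SAME analytic chart `(A, x, D)`, Castella's
two-variable BDP function `L` (T-An-2, verbatim) AND a framed continuous Galois lattice `π : Γ_ℚ →ₜ* GL₂(ℤ_p⟦X⟧)`,
unramified outside `N`, whose reduction mod `(X)` is equivalent over `Ω = ℂ_p` to `V_pE` and whose reduction mod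
`(X − x_t)` is equivalent over `Ω` to Deligne's representation of the member `g_t`, the members being `ℚ_p`-rational.**
Printed content: [Hida1986, Thm. 2.1] «there exists a continuous representation of `𝔊` into `GL₂(𝒦)` … (2.2b) `π` is
unramified outside `Np`; (2.2c) For each ordinary form `f` of weight `k ≥ 2` belonging to `𝒦`, the reduction `π mod P_f`
is equivalent to `π(f)` as a Galois representation into `GL₂(Ω)`», `Ω` = «the p-adic completion of an algebraic closure of
`Q_p`» (Notation), continuity meaning (p. 557) «an `𝓘(𝒦)`-lattice `L` … stable under `𝔊` … `𝔊 → Aut_{𝓘(𝒦)}(L)`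
continuous», with NO hypothesis on the residual representation; read on the chart of T-An-1 through the transcription
(D1)–(D7) of the module docstring (base change along the integral chart `𝓘 → ℤ_p⟦X⟧` and reflexive hull, free over the
regular two-dimensional ring `ℤ_p⟦X⟧` [BrunsHerzog1998] — rider `TU-hull`; reductions at the height-one primes `(X)`,
`(X − x_t)` of `ℤ_p⟦X⟧` = base changes of Hida's `π mod P`; `π(f_{P_t}) ≅ (D t).Δ.ρ ⊗ Ω` and `π(f_E) ≅ V_pE ⊗ Ω` by
characteristic polynomials — riders `TU-ident`, (D7₀); members `ℚ_p`-rational from `κ(P_t) ↪ ℤ_p⟦X⟧/(X − x_t) = ℤ_p` —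
rider `TU-rat`). TRANSCRIPTION: under EXACTLY the binders of `castella2020_exists_twoVariableBDP_on_pNewBranchChart`
(token for token), THERE ARE chart data `(A, x, D)` with `IsPNewBranchAnalyticChart W p ι j A x D`, the CM periods and
`L` of T-An-2 with (an∞), (an_t) VERBATIM, AND `π : FramedGaloisRep ℚ (PowerSeries ℤ_[p]) 2` with
`IsUntwistedBranchGaloisLattice W p x D π` — for the SAME `(x, D)`; dropping the last conjunct recovers T-An-2, and the
tree derives the sibling fact `hida1986_castella2020_exists_galoisLattice_on_pNewBranchChart` (T-An-2ᵍ: critical twist,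
descended conjugacies, remainder form) from this one. Flags `TU-chain`, `TU-hull`, `TU-ident`, `TU-conv`, `TU-rat`,
`TU-Ω`, `TU-p3` (binder `2 < p`; [Hida1986] prints `p ≥ 5`, `p = 3` by [Wiles1988] §2.2/Thm. 2.2.1 — number/content/odd-`p` scope
confirmed first-hand in [SkinnerWiles1999] §3.3 and [GhateVatsal2004] §2–§3), and every flag of the sibling modules: module
docstrings. Named fact
(D-0014); a conjunction of published results; nothing constructed; no `_holds`; BSD is proved for no curve by this.
[cite: Hida1986, Intro (p. 545), Notation (Ω), Cor. 1.3, Cor. 1.4 (pp. 554–555), §2 Terminology (p. 557), Thm. 2.1 (2.2a)–(2.2c) (p. 557), §8 (pp. 594–599) (Invent. Math. 85 (1986))]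
[cite: Delbourgo2008, Thm. 4.3, §4.2, Cor. 7.3 and the remark "equally valid at p = 3, with the proviso …" (held book, chunks p0088, p0093, p0130, p0186)]
[cite: BrunsHerzog1998, Thm. 1.3.3 (Auslander–Buchsbaum), Prop. 1.4.1, Exercise 1.4.19, Thm. 2.2.7 (Auslander–Buchsbaum–Serre)]
[cite: Castella2020JIMJ, §1.1, §1.2, Def. 2.10, Thm. 2.11, Rem. 2.12] [cite: Castella2018, §2, Thm. 3.1, §4 (4.1), p. 11]
[cite: Castella2018Exceptional, Introduction and §3.2 Thm. 3.4] [cite: CastellaHsieh2018, §3.3 Def. 3.7 and Prop. 3.8]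
[cite: Venerucci2016, §2.1, §2.4] [cite: GreenbergStevens1993, §2] [cite: Skinner2016PacificMC, §2.6]
[cite: Wiles1988, §2.2 (pseudo-representations, odd p) and Thm. 2.2.1 (ordinary Λ-adic Galois representations) (Invent. Math. 94 (1988) 529–573) — the source at p = 3]
[cite: SkinnerWiles1999, §3.3 (3.4) and p. 39 ("the existence of ρ_𝔔 as in the proof of (W2, Theorem 2.2.1)"; p odd, p. 6; their reference W2 = Wiles 1988, p. 126) (Publ. Math. IHES 89)]
[cite: GhateVatsal2004, §2 (p. 2147; p. 2149: "for p ≥ 5; the extension to p = 3 is sketched in (Hid93), via the method of (Wil88)") and §3 (pp. 2149–2150: ρ_F with P(ρ_F) ≅ ρ_f) (Ann. Inst. Fourier 54)]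
[cite: Ribet1977, Thm. 2.3 (irreducibility of ρ_{f,λ})] [cite: Carayol1986, Thm. (A) (local–global compatibility)] [cite: Serre1968, IV §2.2 (V_pE irreducible for non-CM E)] -/
def hida1986_castella2020_exists_untwistedGaloisLattice_on_pNewBranchChart : Prop :=
  ∀ {p : ℕ} [Fact p.Prime] (ι : PadicAlgCl p ≃+* ℂ) (W : WeierstrassCurve ℚ) [W.IsElliptic]
    [W.IsGloballyMinimal] (K : Type) [Field K] [NumberField K]
    (𝔭 : HeightOneSpectrum (𝓞 K)) (κ : ZpExtension K p) (γ : absoluteGaloisGroup K)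
    [Fact (κ.IsTopGenerator γ)] {N : ℕ} [NeZero N] {f : CuspForm (Gamma0 N) 2}
    (_ : IsNewformOf W f),
    -- `f = f_E` of level `N`, `p` an ODD prime with `p ∥ N` (tame level `M = N/p`, `f` `p`-stabilised-new and ordinary)
    W.conductorNorm ℤ = N → 2 < p → W.HasMultiplicativeReductionAtPrime p →
    -- `K` imaginary quadratic, `d_K` odd and `< −4`, every prime of `N = Mp` split in `K` (Heegner for `M`, and `p = 𝔭𝔭̄` split)
    IsImaginaryQuadratic K → Odd (NumberField.discr K) → NumberField.discr K < -4 →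
    SatisfiesHeegnerHypothesis N K →
    ((Ideal.span {(p : ℤ)}).primesOver (𝓞 K)).ncard = 2 →
    -- `𝔭` the prime above `p` induced by `ı_p = ι⁻¹`
    ((p : ℕ) : 𝓞 K) ∈ 𝔭.asIdeal →
    (∀ (w : InfinitePlace K) (y : 𝓞 K), y ∈ 𝔭.asIdeal ↔ ‖ι.symm (w.embedding (y : K))‖ < 1) →
    -- `Γ` THE anticyclotomic `ℤ_p`-extension (`γ` a topological generator, `1 + T ↔ γ`)
    κ.IsAnticyclotomic →
    -- the structure map `j : ℤ_p → R₀` of the chart (characterised by its values in `ℂ_p`)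
    ∀ (j : ℤ_[p] →+* unrIntegers p),
      (∀ z : ℤ_[p], ((j z : unrIntegers p) : ℂ_[p]) = algebraMap ℚ_[p] ℂ_[p] (z : ℚ_[p])) →
    ∃ (A : ℕ → UnrSeries p) (x : ℕ → ℤ_[p]) (D : ℕ → Skinner2016.HidaCongruentForm W p 1),
      -- the chart and the members [Hida86 / GS93: T-An-1's clauses]
      IsPNewBranchAnalyticChart W p ι j A x D ∧
      -- T-An-2 VERBATIM: CM periods and `L = L_p(𝐟)` read on the chart, with (an∞) and (an_t)
      (∃ (ΩK : ℂ) (Ωp : (unrIntegers p)ˣ) (L : PowerSeries (PowerSeries (unrIntegers p))),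
        ΩK ≠ 0 ∧
        -- (an∞) the weight-2 (`X = 0`, `p`-new) fibre generates the ideal of Castella's `L_p(f)` [Cas18 (4.1) at `𝐟_φ = f`, p. 11; Thm. 3.1]
        (∃ L₂ : UnrSeries p, IsBDPLFunction ι 𝔭 κ γ f ΩK ((Ωp : unrIntegers p) : ℂ_[p]) L₂ ∧
          Ideal.span {PowerSeries.map (PowerSeries.constantCoeff (R := unrIntegers p)) L} =
            Ideal.span {L₂}) ∧
        -- (an_t) the fibre at the member point `x_t` generates the ideal of the member's BDP function, SAME periods [Cas18 (4.1); Cas20 Thm. 2.11]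
        (∀ t : ℕ, ∃ (Ψ Lg : UnrSeries p),
          (∃ U : PowerSeries (PowerSeries (unrIntegers p)),
            PowerSeries.map (PowerSeries.C (R := unrIntegers p)) Ψ =
              L + PowerSeries.C (PowerSeries.X - PowerSeries.C (j (x t))) * U) ∧
          IsBDPLFunctionWt ι 𝔭 κ γ (D t).g ΩK ((Ωp : unrIntegers p) : ℂ_[p]) Lg ∧
          Ideal.span {Ψ} = Ideal.span {Lg})) ∧
      -- NEW [Hida86 Thm. 2.1 (2.2b)/(2.2c) on the same branch, VERBATIM shape]: Hida's untwisted lattice on the SAME `(x, D)`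
      ∃ π : FramedGaloisRep ℚ (PowerSeries ℤ_[p]) 2, IsUntwistedBranchGaloisLattice W p x D π

end Literature.NumberTheory.EllipticCurves

end
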